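import Summits.CriticalPhenomena.PercolationContinuityZ3.Theorems.PercNearOneGluingNoHeavyPcintGeodesicExact
import HarnessLib

/-!
# PCINT lane: the geodesic-word union bound is asymptotically EXACT — SITE model (REDUCTIONS.md §R7.1)

Cell `prim-pcint`, seat `prim-pcint-2` (gen 7).  Site twin of `…PcintGeodesicExact` (bond).  Does NOT
build on p205010.

Every certified lower bound of the lane for `p_c^site(ℤ^d)` (kinds B2, B2r, B2c, B2d) is a union bound,
over the words `γ` of length `n`, of window-computable upper estimates for the probability of
`minSiteGeoEvent o γ = {γ is the code-least open geodesic word of length n}` of the site configuration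
(`minSiteGeoEvent_subset_nawRandEvent` = `mem_nawRandEvent_of_minimal`).  As in the bond file the union
bound is an identity at event level — the events are pairwise disjoint (`code_injective`) with union
`siteGeoNonempty d n = {an open geodesic word of length n exists}` (`siteGeoNonempty_eq_biUnion`,
`sum_measureReal_minSiteGeoEvent`) — and `siteGeoNonempty d n` decreases in `n` with intersection EXACTLY
`{|C^site(0)| = ∞}` (`iInter_siteGeoNonempty`; no null set is needed in the site model).  Hence
`Σ_{γ ∈ sawWords d n} P_p(minSiteGeoEvent (o n) γ) → θ^site(p)` from above for every `p` and every choice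
of orders (`tendsto_sum_minSiteGeoEvent`, `siteTheta_le_sum_minSiteGeoEvent`), with limit `0` below
`p_c^site` (`tendsto_sum_minSiteGeoEvent_of_lt_siteCriticalProb`).  All events here are measurable
outright (cylinder descriptions `siteGeoWordEvent`, `minSiteGeoCyl`).
-/

noncomputable section

namespace Summit.CriticalPhenomena.PercolationContinuityZ3.Theorems.Pcint

open Finset MeasureTheory Filter Topology
open Literature.Probability.Percolation Literature.Probability.LatticeModels

variable {d n : ℕ}

/-! ### The events -/

/-- The event "`γ` is THE code-least open geodesic word of length `n`" of a site configuration (orders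
`o`). REDUCTIONS.md §R7.1 (site). [folklore] -/
def minSiteGeoEvent (o : Orders d n) (γ : Fin n → Fin d × Bool) : Set (SiteConfig (Site d)) :=
  {ω | γ ∈ geoWords ω n ∧ ∀ γ' ∈ geoWords ω n, code o γ ≤ code o γ'}

/-- The event "some open geodesic word of length `n` exists" (site model). [folklore] -/
def siteGeoNonempty (d n : ℕ) : Set (SiteConfig (Site d)) := {ω | (geoWords ω n).Nonempty}

/-- The events `minSiteGeoEvent o γ` realise the lane's certified site events:
`minSiteGeoEvent o γ ⊆ nawRandEvent o γ`. [folklore] -/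
theorem minSiteGeoEvent_subset_nawRandEvent (o : Orders d n) (γ : Fin n → Fin d × Bool) :
    minSiteGeoEvent o γ ⊆ nawRandEvent o γ := fun _ ⟨hγ, hmin⟩ => mem_nawRandEvent_of_minimal hγ hmin

/-- Distinct words give DISJOINT events. [folklore] -/
theorem minSiteGeoEvent_disjoint (o : Orders d n) {γ γ' : Fin n → Fin d × Bool} (h : γ ≠ γ') :
    Disjoint (minSiteGeoEvent o γ) (minSiteGeoEvent o γ') := by
  rw [Set.disjoint_left]
  rintro ω ⟨hγ, hmin⟩ ⟨hγ', hmin'⟩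
  exact h (code_injective o (le_antisymm (hmin γ' hγ') (hmin' γ hγ)))

/-- **The union bound is an identity at the level of events** (site): `siteGeoNonempty d n` is the
disjoint union of the `minSiteGeoEvent o γ`, `γ ∈ sawWords d n`, for ANY orders `o`. [folklore] -/
theorem siteGeoNonempty_eq_biUnion (o : Orders d n) :
    siteGeoNonempty d n = ⋃ γ ∈ sawWords d n, minSiteGeoEvent o γ := by
  ext ω
  constructor
  · intro hne
    obtain ⟨γ, hγ, hmin⟩ := exists_min_image (geoWords ω n) (code o) hne
    exact Set.mem_biUnion (mem_coe.2 (mem_sawWords.2 (isSAW_of_mem_geoWords hγ))) ⟨hγ, hmin⟩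
  · intro h
    simp only [Set.mem_iUnion] at h
    obtain ⟨γ, -, hγ⟩ := h
    exact ⟨γ, hγ.1⟩

/-! ### Monotonicity in `n` and the limit event -/

/-- The prefix of an open geodesic word is an open geodesic word (site). [folklore] -/
theorem init_mem_geoWords {ω : SiteConfig (Site d)} {γ : Fin (n + 1) → Fin d × Bool}
    (hγ : γ ∈ geoWords ω (n + 1)) : Fin.init γ ∈ geoWords ω n := by
  obtain ⟨hopen, hdist⟩ := mem_geoWords.1 hγ
  refine mem_geoWords.2 ⟨fun i hi => by rw [wordPos_init γ hi]; exact hopen i (by omega), ?_⟩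
  rw [wordPos_init γ le_rfl]
  obtain ⟨W, hW⟩ := exists_openWalk_wordPos hopen (Nat.zero_le n) (Nat.le_succ n)
  have hWle := SimpleGraph.dist_le W
  rw [hW, wordPos_zero] at hWle
  apply le_antisymm
  · omega
  · by_contra hlt
    push Not at hlt
    obtain ⟨Q, hQ⟩ := W.reachable.exists_walk_length_eq_dist
    have hadj : (siteOpenGraph (zdGraph d) ω).Adj (wordPos γ n) (wordPos γ (n + 1)) :=
      (siteOpenGraph_adj _ _ _ _).2 ⟨zdGraph_adj_wordPos_succ γ (Nat.lt_succ_self n),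
        hopen n (Nat.le_succ n), hopen (n + 1) le_rfl⟩
    have hle := SimpleGraph.dist_le (Q.concat hadj)
    rw [SimpleGraph.Walk.length_concat, hQ, wordPos_zero, hdist] at hle
    omega

/-- `siteGeoNonempty d n` is non-increasing in `n`. [folklore] -/
theorem siteGeoNonempty_antitone (d : ℕ) : Antitone (siteGeoNonempty d) := by
  refine antitone_nat_of_succ_le fun n ω hω => ?_
  obtain ⟨γ, hγ⟩ := hω
  exact ⟨Fin.init γ, init_mem_geoWords hγ⟩

/-- If `C^site(0)` is finite, there is no open geodesic word longer than `|C^site(0)|`. [folklore] -/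
theorem geoWords_eq_empty_of_finite {ω : SiteConfig (Site d)}
    (hfin : (siteCluster (zdGraph d) ω 0).Finite) (hn : hfin.toFinset.card ≤ n) : geoWords ω n = ∅ := by
  rw [Finset.eq_empty_iff_forall_notMem]
  intro γ hγ
  have hopen := (mem_geoWords.1 hγ).1
  have hsaw := isSAW_of_mem_geoWords hγ
  have h0 : (0 : Site d) ∈ ω := by simpa using hopen 0 (Nat.zero_le n)
  have hmaps : ∀ i ∈ range (n + 1), wordPos γ i ∈ hfin.toFinset := by
    intro i hi
    have hi' : i ≤ n := Nat.le_of_lt_succ (mem_range.1 hi)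
    rw [Set.Finite.mem_toFinset]
    obtain ⟨W, -⟩ := exists_openWalk_wordPos hopen (Nat.zero_le i) hi'
    rw [wordPos_zero] at W
    exact ⟨h0, hopen i hi', ⟨W⟩⟩
  have hinj : Set.InjOn (fun i => wordPos γ i) ↑(range (n + 1)) := fun i hi j hj h =>
    hsaw i j (Nat.le_of_lt_succ (mem_range.1 (mem_coe.1 hi))) (Nat.le_of_lt_succ (mem_range.1 (mem_coe.1 hj))) h
  have := Finset.card_le_card_of_injOn _ hmaps hinj
  rw [card_range] at this
  omega

/-- **The limit event** (site): an open geodesic word of EVERY length exists iff `|C^site(0)| = ∞`.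
[folklore] -/
theorem iInter_siteGeoNonempty (d : ℕ) :
    (⋂ n, siteGeoNonempty d n) = sitePercolatesAt (zdGraph d) (0 : Site d) := by
  ext ω
  simp only [Set.mem_iInter, siteGeoNonempty, Set.mem_setOf_eq]
  constructor
  · intro h
    by_contra hfin
    have hfin' : (siteCluster (zdGraph d) ω 0).Finite := Set.not_infinite.1 hfin
    have := h hfin'.toFinset.card
    rw [geoWords_eq_empty_of_finite hfin' le_rfl] at this
    exact Finset.not_nonempty_empty this
  · exact fun h n => geoWords_nonempty_of_sitePercolatesAt h n

/-- `{|C^site(0)| = ∞} ⊆ siteGeoNonempty d n` for every `n`. [folklore] -/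
theorem sitePercolatesAt_subset_siteGeoNonempty (d n : ℕ) :
    sitePercolatesAt (zdGraph d) (0 : Site d) ⊆ siteGeoNonempty d n := fun _ h =>
  geoWords_nonempty_of_sitePercolatesAt h n

/-! ### Measurability -/

/-- The event "some word of length `k` ending at `x` has all its sites open". [folklore] -/
def openSiteWordTo (k : ℕ) (x : Site d) : Set (SiteConfig (Site d)) :=
  {ω | ∃ w : Fin k → Fin d × Bool, wordPos w k = x ∧ ∀ i ≤ k, wordPos w i ∈ ω}

/-- "All sites of the word `w` are open" is measurable (a finite-dimensional cylinder). [folklore] -/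
theorem measurableSet_wordSites_open {k : ℕ} (w : Fin k → Fin d × Bool) :
    MeasurableSet {ω : SiteConfig (Site d) | ∀ i ≤ k, wordPos w i ∈ ω} := by
  have : {ω : SiteConfig (Site d) | ∀ i ≤ k, wordPos w i ∈ ω} = ⋂ i ∈ range (k + 1), {ω | wordPos w i ∈ ω} := by
    ext ω
    simp only [Set.mem_setOf_eq, Set.mem_iInter, mem_range, Nat.lt_succ_iff]
  rw [this]
  exact (range (k + 1)).measurableSet_biInter fun i _ => measurableSet_mem _

/-- `openSiteWordTo k x` is measurable. [folklore] -/
theorem measurableSet_openSiteWordTo (k : ℕ) (x : Site d) : MeasurableSet (openSiteWordTo (d := d) k x) := by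
  have : openSiteWordTo (d := d) k x =
      ⋃ w : Fin k → Fin d × Bool, ({ω | wordPos w k = x} ∩ {ω | ∀ i ≤ k, wordPos w i ∈ ω}) := by
    ext ω
    simp only [openSiteWordTo, Set.mem_setOf_eq, Set.mem_iUnion, Set.mem_inter_iff]
  rw [this]
  exact MeasurableSet.iUnion fun w => (MeasurableSet.const _).inter (measurableSet_wordSites_open w)

/-- Cylinder description of "`γ` is an open geodesic word" (site): its sites are open and no word
shorter than `n` ending at its endpoint has all sites open. [folklore] -/
def siteGeoWordEvent (γ : Fin n → Fin d × Bool) : Set (SiteConfig (Site d)) :=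
  {ω | ∀ i ≤ n, wordPos γ i ∈ ω} ∩ ⋂ k ∈ range n, (openSiteWordTo k (wordPos γ n))ᶜ

/-- `siteGeoWordEvent γ` is measurable. [folklore] -/
theorem measurableSet_siteGeoWordEvent (γ : Fin n → Fin d × Bool) : MeasurableSet (siteGeoWordEvent γ) :=
  (measurableSet_wordSites_open γ).inter
    ((range n).measurableSet_biInter fun k _ => (measurableSet_openSiteWordTo k _).compl)

/-- `γ ∈ geoWords ω n ↔ ω ∈ siteGeoWordEvent γ`. [folklore] -/
theorem mem_geoWords_iff_mem_siteGeoWordEvent (ω : SiteConfig (Site d)) (γ : Fin n → Fin d × Bool) :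
    γ ∈ geoWords ω n ↔ ω ∈ siteGeoWordEvent γ := by
  have hG : siteOpenGraph (zdGraph d) ω ≤ zdGraph d := fun a b hab => ((siteOpenGraph_adj _ _ _ _).1 hab).1
  rw [mem_geoWords, siteGeoWordEvent, Set.mem_inter_iff, Set.mem_setOf_eq]
  refine and_congr_right fun hopen => ?_
  simp only [Set.mem_iInter, Set.mem_compl_iff, mem_range]
  constructor
  · intro hdist k hk hk'
    obtain ⟨w, hwx, hwo⟩ := hk'
    obtain ⟨W, hW⟩ := exists_openWalk_wordPos hwo (Nat.zero_le k) le_rfl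
    have := SimpleGraph.dist_le W
    rw [hW, wordPos_zero, hwx] at this
    omega
  · intro h
    obtain ⟨W, hW⟩ := exists_openWalk_wordPos hopen (Nat.zero_le n) le_rfl
    have hWle := SimpleGraph.dist_le W
    rw [hW, wordPos_zero] at hWle
    apply le_antisymm
    · omega
    · by_contra hlt
      push Not at hlt
      obtain ⟨Q, hQ⟩ := W.reachable.exists_walk_length_eq_dist
      set m := (siteOpenGraph (zdGraph d) ω).dist 0 (wordPos γ n) with hm
      have hQ' : (Q.copy (wordPos_zero γ) rfl).length = m := by
        rw [SimpleGraph.Walk.length_copy, hQ, wordPos_zero]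
      obtain ⟨w, hw⟩ := exists_word_of_walk hG (Q.copy (wordPos_zero γ) rfl) m (by omega)
      refine h m hlt ⟨w, ?_, fun i hi => ?_⟩
      · rw [hw m le_rfl, ← hQ', SimpleGraph.Walk.getVert_length]
      · rw [hw i hi]
        rcases Nat.eq_zero_or_pos i with rfl | hpos
        · rw [SimpleGraph.Walk.getVert_zero]
          simpa using hopen 0 (Nat.zero_le n)
        · obtain ⟨k, rfl⟩ : ∃ k, i = k + 1 := ⟨i - 1, by omega⟩
          exact ((siteOpenGraph_adj _ _ _ _).1
            ((Q.copy (wordPos_zero γ) rfl).adj_getVert_succ (by omega : k < _))).2.2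

/-- Cylinder description of `minSiteGeoEvent o γ`. [folklore] -/
def minSiteGeoCyl (o : Orders d n) (γ : Fin n → Fin d × Bool) : Set (SiteConfig (Site d)) :=
  siteGeoWordEvent γ ∩ ⋂ γ' ∈ (univ.filter fun γ' => code o γ' < code o γ), (siteGeoWordEvent γ')ᶜ

/-- `minSiteGeoEvent o γ` equals its cylinder description. [folklore] -/
theorem minSiteGeoEvent_eq_minSiteGeoCyl (o : Orders d n) (γ : Fin n → Fin d × Bool) :
    minSiteGeoEvent o γ = minSiteGeoCyl o γ := by
  ext ω
  rw [minSiteGeoEvent, Set.mem_setOf_eq, minSiteGeoCyl, Set.mem_inter_iff,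
    mem_geoWords_iff_mem_siteGeoWordEvent ω]
  refine and_congr_right fun _ => ?_
  simp only [Set.mem_iInter, Set.mem_compl_iff, mem_filter, mem_univ, true_and]
  constructor
  · intro h γ' hlt hγ'
    exact absurd (h γ' ((mem_geoWords_iff_mem_siteGeoWordEvent ω γ').2 hγ')) (not_le.2 hlt)
  · intro h γ' hγ'
    by_contra hlt
    exact h γ' (not_le.1 hlt) ((mem_geoWords_iff_mem_siteGeoWordEvent ω γ').1 hγ')

/-- `minSiteGeoEvent o γ` is measurable. [folklore] -/
theorem measurableSet_minSiteGeoEvent (o : Orders d n) (γ : Fin n → Fin d × Bool) :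
    MeasurableSet (minSiteGeoEvent o γ) := by
  rw [minSiteGeoEvent_eq_minSiteGeoCyl]
  exact (measurableSet_siteGeoWordEvent γ).inter
    (Finset.measurableSet_biInter _ fun γ' _ => (measurableSet_siteGeoWordEvent γ').compl)

/-- `siteGeoNonempty d n` is measurable. [folklore] -/
theorem measurableSet_siteGeoNonempty (d n : ℕ) : MeasurableSet (siteGeoNonempty d n) := by
  rw [siteGeoNonempty_eq_biUnion (fun _ => Equiv.refl _)]
  exact Finset.measurableSet_biUnion _ fun γ _ => measurableSet_minSiteGeoEvent _ γ

/-! ### Measure statements -/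

/-- **The union bound is an identity** (site): `Σ_{γ ∈ sawWords d n} P_p(minSiteGeoEvent o γ) =
P_p(siteGeoNonempty d n)` for every `n`, `p`, `o`. [folklore] -/
theorem sum_measureReal_minSiteGeoEvent (d n : ℕ) (p : unitInterval) (o : Orders d n) :
    ∑ γ ∈ sawWords d n, (sitePercolation (Site d) p).real (minSiteGeoEvent o γ) =
      (sitePercolation (Site d) p).real (siteGeoNonempty d n) := by
  rw [siteGeoNonempty_eq_biUnion o, measureReal_biUnion_finset]
  · intro γ _ γ' _ hne
    exact minSiteGeoEvent_disjoint o hne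
  · intro γ _
    exact measurableSet_minSiteGeoEvent o γ

/-- Below `p_c^site`, `θ^site = 0` (no coupling needed: `p_c^site` is an infimum). [folklore] -/
theorem siteTheta_zd_eq_zero_of_lt_siteCriticalProb (d : ℕ) (p : unitInterval)
    (hp : (p : ℝ) < siteCriticalProb (zdGraph d) 0) : siteTheta (zdGraph d) 0 p = 0 := by
  by_contra hne
  have hpos : 0 < siteTheta (zdGraph d) 0 p := lt_of_le_of_ne measureReal_nonneg (Ne.symm hne)
  have hle : siteCriticalProb (zdGraph d) 0 ≤ p := by
    refine csInf_le ⟨0, fun q hq => ?_⟩ (Or.inl ⟨p.2, by simpa using hpos⟩)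
    rcases hq with ⟨h, -⟩ | h
    · exact h.1
    · rw [Set.mem_singleton_iff] at h
      rw [h]; exact zero_le_one
  exact absurd hp (not_lt.2 hle)

/-- **Every term dominates `θ^site(p)`**: `θ^site(p) ≤ P_p(siteGeoNonempty d n)`. [folklore] -/
theorem siteTheta_le_measureReal_siteGeoNonempty (d n : ℕ) (p : unitInterval) :
    siteTheta (zdGraph d) 0 p ≤ (sitePercolation (Site d) p).real (siteGeoNonempty d n) :=
  measureReal_mono (sitePercolatesAt_subset_siteGeoNonempty d n)

/-- **Every term dominates `θ^site(p)`** (sum form). [folklore] -/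
theorem siteTheta_le_sum_minSiteGeoEvent (d n : ℕ) (p : unitInterval) (o : Orders d n) :
    siteTheta (zdGraph d) 0 p ≤
      ∑ γ ∈ sawWords d n, (sitePercolation (Site d) p).real (minSiteGeoEvent o γ) := by
  rw [sum_measureReal_minSiteGeoEvent]
  exact siteTheta_le_measureReal_siteGeoNonempty d n p

/-- `n ↦ P_p(siteGeoNonempty d n)` is non-increasing. [folklore] -/
theorem measureReal_siteGeoNonempty_antitone (d : ℕ) (p : unitInterval) :
    Antitone fun n => (sitePercolation (Site d) p).real (siteGeoNonempty d n) :=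
  fun _ _ h => measureReal_mono (siteGeoNonempty_antitone d h)

/-- **Exactness of the union bound** (site): `P_p(siteGeoNonempty d n) → θ^site(p)`. [folklore] -/
theorem tendsto_measureReal_siteGeoNonempty (d : ℕ) (p : unitInterval) :
    Tendsto (fun n => (sitePercolation (Site d) p).real (siteGeoNonempty d n)) atTop
      (𝓝 (siteTheta (zdGraph d) 0 p)) := by
  set μ := sitePercolation (Site d) p with hμ
  have hlim := tendsto_measure_iInter_atTop (μ := μ)
    (fun n => (measurableSet_siteGeoNonempty d n).nullMeasurableSet) (siteGeoNonempty_antitone d)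
    ⟨0, measure_ne_top μ _⟩
  rw [iInter_siteGeoNonempty] at hlim
  rw [siteTheta]
  simp only [measureReal_def]
  exact (ENNReal.tendsto_toReal (measure_ne_top μ _)).comp hlim

/-- **Exactness of the geodesic-word union bound, site model (REDUCTIONS.md §R7.1).** For every `p` and
every choice of sibling orders `o n`, `Σ_{γ ∈ sawWords d n} P_p(γ is the code-least open geodesic word
of length n) → θ^site(p)` as `n → ∞`, from above (`siteTheta_le_sum_minSiteGeoEvent`). [folklore] -/
theorem tendsto_sum_minSiteGeoEvent (d : ℕ) (p : unitInterval) (o : ∀ n, Orders d n) :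
    Tendsto (fun n => ∑ γ ∈ sawWords d n, (sitePercolation (Site d) p).real (minSiteGeoEvent (o n) γ))
      atTop (𝓝 (siteTheta (zdGraph d) 0 p)) := by
  simp only [sum_measureReal_minSiteGeoEvent]
  exact tendsto_measureReal_siteGeoNonempty d p

/-- Below `p_c^site` the exact union bound tends to `0`. [folklore] -/
theorem tendsto_sum_minSiteGeoEvent_of_lt_siteCriticalProb (d : ℕ) (p : unitInterval)
    (o : ∀ n, Orders d n) (hp : (p : ℝ) < siteCriticalProb (zdGraph d) 0) :
    Tendsto (fun n => ∑ γ ∈ sawWords d n, (sitePercolation (Site d) p).real (minSiteGeoEvent (o n) γ))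
      atTop (𝓝 0) := by
  have h := tendsto_sum_minSiteGeoEvent d p o
  rwa [siteTheta_zd_eq_zero_of_lt_siteCriticalProb d p hp] at h

end Summit.CriticalPhenomena.PercolationContinuityZ3.Theorems.Pcint
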